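import Literature.Analysis.FluidPDE.DeRosaStep
import Literature.Analysis.FluidPDE.FractionalNSReynoldsLimit
import Literature.Analysis.FluidPDE.FractionalNSPrescribedEnergy
import Literature.Analysis.FluidPDE.OnsagerFlexibilityProofs
import Literature.Analysis.FluidPDE.OnsagerBDSVParameters
import HarnessLib

/-!
# De Rosa 2019, Thm. 2.1 from the iteration and the time-regularity step (the assembly of §4.2)

Analysis/FluidPDE proofs file (definition-free). It PROVES

* `DeRosa2019_thm21_of_schemeLT : DeRosa.iterativeSchemeLT → DeRosa.timeRegularity → DeRosa2019_thm21`
  (root-level name `DeRosa2019_thm21_of_iterativeSchemeLT_of_timeRegularity`),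

i.e. the deduction of De Rosa's Thm. 2.1 (prescribed-energy Hölder solutions of the
hypodissipative Navier–Stokes system; the named fact `DeRosa2019_thm21` of
`FractionalNSPrescribedEnergy`, sole remaining hypothesis of the barrier
`Literature.Barriers.NavierStokesRegularity.HypodissipativeLerayNonuniqueness`) from two named
facts — Prop. 4.1 run from zero in the regime `γ < β` (`DeRosa.iterativeSchemeLT`, `DeRosaStep.lean`:
the part of Prop. 4.1 that its printed proof covers, stated with the vocabulary of
`DeRosaScheme.lean`) and the time-regularity step (`DeRosa.timeRegularity`, `DeRosaScheme.lean`) —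
following §4.2 of the paper (arXiv:1801.10235, pp. 8–10) and the tree's formalisation of the
parallel deduction for the Euler scheme (`OnsagerFlexibilityProofs`, BDSV 2019 §2.2), whose lemmas
(`BDSV.*`) are reused. The deduction runs the scheme with a Hölder exponent `βₛ > β > γ`, i.e. in
the regime `γ < βₛ` of the iteration, which is why the restricted fact suffices (Prop. 4.1 is
printed for `β, γ ∈ (0, 1/3)` independent, but its printed proof covers only `γ < β`; see the
module docstring of `DeRosaStep.lean`).

## The argument (De Rosa 2019, §4.2), as formalised

Fix `0 < γ < β < 1/3` (the exponents of `DeRosa2019_thm21`). Choose scheme exponents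
`β < β' < βₛ < 1/3`, `b` with `1 < b < min{(1-βₛ)/(2βₛ), 4/3}`, the constant `M`, `α₀`, an
`α ∈ (0, α₀)` and `a₀` of Prop. 4.1, and a threshold `a⋆ ≥ max(a₀, 2)` with `a⋆^{-α} ≤ 1/2` (`aS` in the code). The
window of the fact is `c₀ = T₀ = 1` (profiles `½ ≤ e ≤ 1`, `|e'| ≤ K` on `[0,1]`, as printed).
Given `K > 1` put `a = max(a⋆, K^{1/(3βₛb)})`, `δ₁ = λ₁^{-2βₛ}`, `μ = δ₁^{1/2}` and `c = μ⁻¹`: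

1. *Normalisation* ((4.11)–(4.13)): `ẽ(s) = δ₁ e(μ s)` on `[0, c]` is a normalised profile
   (`|ẽ'| = δ₁^{3/2}|e'| ≤ δ₁^{3/2} K ≤ 1` because `δ₁ ≤ a^{-2bβₛ} ≤ K^{-2/3}`) with
   `δ₁ λ₀^{-α} ≤ δ₁/2 ≤ ẽ ≤ δ₁` (`BDSV.isNormalisedProfile_rescale`, `BDSV.inductiveEstimates_zero`),
   i.e. admissible for the iteration (`DeRosa.IsAdmissibleProfile`).
2. *Iteration* (`DeRosa.iterativeSchemeLT` with viscosity `ν = μ ∈ (0,1)` on `[0, c]`): a De Rosa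
   sequence `(v_q, p_q, R_q)` from zero with (4.7)–(4.10), (4.12).
3. *Uniform convergence* `v_q → ũ` (increments `≤ M λ_{q+1}^{-βₛ}`, summable), with the limit taken
   pointwise by `limUnder` so that it is a FUNCTION of the profile; `‖R_q‖₀ ≤ δ_{q+1} → 0`; `ũ`
   solves the viscosity-`μ` system weakly (`Torus.isWeakFracNSSolutionOn_of_unifLimit`).
4. *Spatial Hölder bounds* by interpolation (`norm_increment_sub_le`, any `θ ≤ 1`):
   `[v_q(s)]_θ ≤ ∑_k (2M)^{1-θ}(6M)^θ λ_{k+1}^{θ-βₛ} ≤ H_θ`, a bound independent of `q, s` AND of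
   `a ≥ aS` (geometric majorant in `aS`, `exists_holderSum_le`, `norm_sub_le_holderSum`); used with `θ = β'` (time regularity) and
   `θ = β` (the bound of the fact).
5. *Undo the scaling*: `v(t) = c ũ(ct)` on `[0,1]`, the rescaled triples solve the viscosity-`1`
   system (`Torus.IsFracNSReynoldsOn.timeRescale`, `c μ = 1`, `c/c = 1`), converge uniformly to `v`
   with vanishing stresses, so `v` is a weak solution on `(0,1)` and, by `DeRosa.timeRegularity`
   (exponent `β < β'`), `v ∈ C^β([0,1] × 𝕋³)`; `∫|v(t)|² = c² ẽ(ct) = c² δ₁ e(t) = e(t)`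
   (`BDSV.integral_norm_sq_eq_of_unifLimit`); and `‖v(t)‖_∞ + [v(t)]_β ≤ c (1 + H_β)` with
   `c = λ₁^{βₛ} ≤ (4π a^b)^{βₛ} ≤ (4π)^{βₛ} a⋆^{bβₛ} K^{1/3} ≤ C K^{4/9}`.
6. *Same datum*: profiles with `e₁(0) = e₂(0)` have `ẽ₁(0) = ẽ₂(0)`, hence (agreement clause of
   `DeRosa.iterativeSchemeLT`) equal time-zero slices at every stage, hence equal pointwise limits at
   `t = 0`.

## References

* L. De Rosa, Comm. PDE 44 (2019), 335–365 = arXiv:1801.10235, §2 Thm. 2.1, §4.1 Prop. 4.1,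
  §4.2 (proof of Thm. 2.1). [`Derosa2018`]
* T. Buckmaster, C. De Lellis, L. Székelyhidi Jr., V. Vicol, CPAM 72 (2019), §2.2. [`BuckmasterEtAl2018`]
-/

open MeasureTheory Set Filter Topology
open scoped NNReal ENNReal ContDiff

noncomputable section

namespace Literature.Analysis.FluidPDE

namespace DeRosa

/-! ## Lemmas on the parameters -/

section Parameters

/-- Monotonicity in `a` of the geometric majorant of `λ_q(a)^{-g}`: for `1 < aS ≤ a`, `b ≥ 1`,
`g ≥ 0`, `λ_q(a)^{-g} ≤ aS^{-g} (aS^{-g(b-1)})^q`. [folklore] -/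
theorem freq_rpow_neg_le_of_le {aS a b g : ℝ} (haS : 1 < aS) (ha : aS ≤ a) (hb : 1 ≤ b)
    (hg : 0 ≤ g) (q : ℕ) :
    BDSV.freq a b q ^ (-g) ≤ aS ^ (-g) * (aS ^ (-(g * (b - 1)))) ^ q := by
  have ha1 : 1 < a := lt_of_lt_of_le haS ha
  refine (BDSV.freq_rpow_neg_le ha1 hb hg q).trans ?_
  have h1 : a ^ (-g) ≤ aS ^ (-g) := Real.rpow_le_rpow_of_nonpos (by linarith) ha (by linarith)
  have h2 : a ^ (-(g * (b - 1))) ≤ aS ^ (-(g * (b - 1))) :=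
    Real.rpow_le_rpow_of_nonpos (by linarith) ha (by nlinarith)
  have h3 : (a ^ (-(g * (b - 1)))) ^ q ≤ (aS ^ (-(g * (b - 1)))) ^ q :=
    pow_le_pow_left₀ (Real.rpow_nonneg (by linarith) _) h2 q
  exact mul_le_mul h1 h3 (pow_nonneg (Real.rpow_nonneg (by linarith) _) q)
    (Real.rpow_nonneg (by linarith) _)

/-- **Uniform bound for the Hölder sums of the scheme**: for `1 < aS`, `1 < b`, `g > 0` and
`Kc ≥ 0` there is `H ≥ 0` with `∑_{k < q} Kc λ_{k+1}(a)^{-g} ≤ H` for every `a ≥ aS` and every `q`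
(comparison with the geometric series at `aS`). [folklore] -/
theorem exists_holderSum_le {aS b g Kc : ℝ} (haS : 1 < aS) (hb : 1 < b) (hg : 0 < g)
    (hKc : 0 ≤ Kc) :
    ∃ H : ℝ, 0 ≤ H ∧ ∀ a : ℝ, aS ≤ a → ∀ q : ℕ,
      ∑ k ∈ Finset.range q, Kc * BDSV.freq a b (k + 1) ^ (-g) ≤ H := by
  set r : ℝ := aS ^ (-(g * (b - 1))) with hr
  have hr0 : 0 ≤ r := Real.rpow_nonneg (by linarith) _
  have hr1 : r < 1 := Real.rpow_lt_one_of_one_lt_of_neg haS (by nlinarith)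
  have hgeom : Summable fun k : ℕ => r ^ (k + 1) :=
    (summable_geometric_of_lt_one hr0 hr1).comp_injective (add_left_injective 1)
  set S : ℝ := ∑' k : ℕ, r ^ (k + 1) with hS
  have hS0 : 0 ≤ S := tsum_nonneg fun k => pow_nonneg hr0 _
  refine ⟨Kc * aS ^ (-g) * S, by positivity, fun a ha q => ?_⟩
  have hterm : ∀ k, Kc * BDSV.freq a b (k + 1) ^ (-g) ≤ Kc * aS ^ (-g) * r ^ (k + 1) := fun k => by
    rw [mul_assoc]
    exact mul_le_mul_of_nonneg_left (freq_rpow_neg_le_of_le haS ha hb.le hg.le (k + 1)) hKc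
  calc ∑ k ∈ Finset.range q, Kc * BDSV.freq a b (k + 1) ^ (-g)
      ≤ ∑ k ∈ Finset.range q, Kc * aS ^ (-g) * r ^ (k + 1) := Finset.sum_le_sum fun k _ => hterm k
    _ = Kc * aS ^ (-g) * ∑ k ∈ Finset.range q, r ^ (k + 1) := by rw [Finset.mul_sum]
    _ ≤ Kc * aS ^ (-g) * S := by
        refine mul_le_mul_of_nonneg_left ?_ (by positivity)
        exact hgeom.sum_le_tsum _ (fun k _ => pow_nonneg hr0 _)

end Parameters

/-! ## Hölder bounds for the increments of a fractional Navier–Stokes–Reynolds sequence -/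

section Increments

/-- **Interpolated Hölder bound for one increment** (De Rosa 2019, §4.2:
`‖v_{q+1} - v_q‖_{β'} ≲ ‖v_{q+1} - v_q‖₀^{1-β'} ‖v_{q+1} - v_q‖₁^{β'} ≲ λ_q^{β'-β}`; the
`IsFracNSReynoldsOn` twin of `BDSV.norm_increment_sub_le`, whose solution hypotheses serve only the
smoothness of the slices): for `θ ∈ [0,1]`,
`|w(t,x) - w(t,y)| ≤ (2M)^{1-θ} (6M)^θ λ_{q+1}^{θ-β} dist(x,y)^θ`, `w = v_{q+1} - v_q`.
[cite: Derosa2018, §4.2 (interpolation display)] -/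
theorem norm_increment_sub_le {M β θ' ν T a b : ℝ} {q : ℕ}
    {v v' : ℝ → UnitAddTorus (Fin 3) → EuclideanSpace ℝ (Fin 3)}
    {p p' : ℝ → UnitAddTorus (Fin 3) → ℝ}
    {R R' : ℝ → UnitAddTorus (Fin 3) → Fin 3 → EuclideanSpace ℝ (Fin 3)}
    (hv : Torus.IsFracNSReynoldsOn (Icc 0 T) θ' ν v p R)
    (hv' : Torus.IsFracNSReynoldsOn (Icc 0 T) θ' ν v' p' R')
    (hVI : BDSV.VelocityIncrementBound M β a b T q (fun t x => v' t x - v t x)) (hT : 0 ≤ T)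
    (ha : 1 ≤ a) (hM : 0 ≤ M) {θ : ℝ} (hθ0 : 0 ≤ θ) (hθ1 : θ ≤ 1) {t : ℝ} (ht : t ∈ Icc 0 T)
    (x y : UnitAddTorus (Fin 3)) :
    ‖(v' t x - v t x) - (v' t y - v t y)‖ ≤
      ((2 * M) ^ (1 - θ) * (6 * M) ^ θ * BDSV.freq a b (q + 1) ^ (θ - β)) * dist x y ^ θ := by
  obtain ⟨B₀, B₁, hB₀, hB₁, hsup, hder, hB₀ε, hB₁ε⟩ := hVI.exists_bounds hT ha
  have hw : FunctionSpaces.Torus.IsSmooth (fun x => v' t x - v t x) :=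
    (hv'.smooth_velocity.isSmooth_slice ht).sub (hv.smooth_velocity.isSmooth_slice ht)
  have hLip := BDSV.lipschitzWith_of_derivSupLE hB₁ hder ht hw
  have hint := BDSV.norm_sub_le_interpolate (w := fun x => v' t x - v t x)
    (fun x => hsup t ht x) hLip hθ0 hθ1 x y
  refine hint.trans ?_
  rw [Real.coe_toNNReal _ (by positivity)]
  have hl := BDSV.freq_pos (b := b) ha (q + 1)
  have hd : 0 ≤ dist x y ^ θ := Real.rpow_nonneg dist_nonneg _
  refine mul_le_mul_of_nonneg_right ?_ hd
  calc (2 * B₀) ^ (1 - θ) * (6 * B₁) ^ θ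
      ≤ (2 * (M * BDSV.freq a b (q + 1) ^ (-β))) ^ (1 - θ) *
          (6 * (BDSV.freq a b (q + 1) * (M * BDSV.freq a b (q + 1) ^ (-β)))) ^ θ := by
        gcongr
    _ = (2 * M) ^ (1 - θ) * (6 * M) ^ θ * BDSV.freq a b (q + 1) ^ (θ - β) := BDSV.holderConst_eq hl hM

/-- **Hölder bounds along a De Rosa sequence**: summing `norm_increment_sub_le` from `v₀ = 0`,
`‖v_q(t,x) - v_q(t,y)‖ ≤ (∑_{k<q} (2M)^{1-θ}(6M)^θ λ_{k+1}^{-(β-θ)}) dist(x,y)^θ` for `θ ∈ [0,1]`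
(De Rosa 2019, §4.2: "hence `v_q` is uniformly bounded in `C⁰_t C^{β'}_x`").
[cite: Derosa2018, §4.2] -/
theorem norm_sub_le_holderSum {M β γ α a b ν T : ℝ} {e : ℝ → ℝ}
    {v : ℕ → ℝ → UnitAddTorus (Fin 3) → EuclideanSpace ℝ (Fin 3)}
    {p : ℕ → ℝ → UnitAddTorus (Fin 3) → ℝ}
    {R : ℕ → ℝ → UnitAddTorus (Fin 3) → Fin 3 → EuclideanSpace ℝ (Fin 3)}
    (hs : IsDeRosaSequence M β γ α a b ν T e v p R) (hT : 0 ≤ T) (ha : 1 ≤ a) (hM : 0 ≤ M)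
    {θ : ℝ} (hθ0 : 0 ≤ θ) (hθ1 : θ ≤ 1) (q : ℕ) {t : ℝ} (ht : t ∈ Icc 0 T)
    (x y : UnitAddTorus (Fin 3)) :
    ‖v q t x - v q t y‖ ≤
      (∑ k ∈ Finset.range q, ((2 * M) ^ (1 - θ) * (6 * M) ^ θ) * BDSV.freq a b (k + 1) ^ (-(β - θ))) *
        dist x y ^ θ := by
  induction q with
  | zero =>
      simp [hs.velocity_zero]
  | succ q ih =>
      have hw := norm_increment_sub_le (hs.isFracNSReynoldsOn q) (hs.isFracNSReynoldsOn (q + 1))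
        (hs.velocityIncrementBound q) hT ha hM hθ0 hθ1 ht x y
      rw [show (θ - β) = -(β - θ) by ring] at hw
      calc ‖v (q + 1) t x - v (q + 1) t y‖
          = ‖(v q t x - v q t y) + ((v (q + 1) t x - v q t x) - (v (q + 1) t y - v q t y))‖ := by
            congr 1; abel
        _ ≤ ‖v q t x - v q t y‖ + ‖(v (q + 1) t x - v q t x) - (v (q + 1) t y - v q t y)‖ :=
            norm_add_le _ _
        _ ≤ (∑ k ∈ Finset.range q, ((2 * M) ^ (1 - θ) * (6 * M) ^ θ) * BDSV.freq a b (k + 1) ^ (-(β - θ))) *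
                dist x y ^ θ +
              ((2 * M) ^ (1 - θ) * (6 * M) ^ θ * BDSV.freq a b (q + 1) ^ (-(β - θ))) * dist x y ^ θ :=
            add_le_add ih hw
        _ = (∑ k ∈ Finset.range (q + 1), ((2 * M) ^ (1 - θ) * (6 * M) ^ θ) * BDSV.freq a b (k + 1) ^ (-(β - θ))) *
              dist x y ^ θ := by
            rw [Finset.sum_range_succ]; ring

end Increments

/-! ## The assembly -/

section Assembly

/-- Choice of the scheme exponents: given `γ < β < 1/3`, exponents `β < β' < βₛ < 1/3` with `β'`
as a nonnegative real (for `DeRosa.timeRegularity`). [folklore] -/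
theorem exists_scheme_exponents {β : ℝ} (hβ0 : 0 < β) (hβ : β < 1 / 3) :
    ∃ (β' : ℝ≥0) (βs : ℝ), β < (β' : ℝ) ∧ (0 : ℝ≥0) < β' ∧ β' < 1 / 3 ∧ (β' : ℝ) ≤ 1 ∧
      (β' : ℝ) < βs ∧ 0 < βs ∧ βs < 1 / 3 ∧ Real.toNNReal β < β' := by
  set x : ℝ := (β + 1 / 3) / 2 with hx
  have hx0 : 0 < x := by positivity
  have hcoe : ((Real.toNNReal x : ℝ≥0) : ℝ) = x := Real.coe_toNNReal x hx0.le
  refine ⟨Real.toNNReal x, (x + 1 / 3) / 2, ?_, ?_, ?_, ?_, ?_, ?_, ?_, ?_⟩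
  · rw [hcoe]; linarith
  · exact Real.toNNReal_pos.2 hx0
  · rw [← NNReal.coe_lt_coe, hcoe]; push_cast; linarith
  · rw [hcoe]; linarith
  · rw [hcoe]; linarith
  · linarith
  · linarith
  · exact (Real.toNNReal_lt_toNNReal_iff hx0).2 (by linarith)

/-- **The rescaled profile is admissible** (De Rosa 2019, §4.2, (4.11)–(4.13)): for a profile
`e` of the window of `DeRosa2019_thm21` (`½ ≤ e ≤ 1`, `|e'| ≤ K` on `[0,1]`, smooth), the
rescaling `ẽ(s) = δ₁ e(s/c)` on `[0, c]` is a normalised profile making the zero triple satisfy the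
stage-`0` estimates, as soon as `δ₁ K ≤ c` (i.e. `δ₁^{3/2} K ≤ 1` for `c = δ₁^{-1/2}`) and
`λ₀^{-α} ≤ ½`. [cite: Derosa2018, §4.2 (4.11)–(4.13)] -/
theorem isAdmissibleProfile_rescale {M βs α a b c K : ℝ} {e : ℝ → ℝ} (hM : 0 ≤ M) (hβs : 0 ≤ βs)
    (ha : 1 ≤ a) (hc : 0 < c) (hKc : BDSV.amp βs a b 1 * K ≤ c)
    (hlam0 : BDSV.freq a b 0 ^ (-α) ≤ 1 / 2) (he : IsEnergyProfile 1 1 K e) :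
    IsAdmissibleProfile M βs α a b c (fun s => BDSV.amp βs a b 1 * e (c⁻¹ * s)) := by
  have hδ₁ : 0 < BDSV.amp βs a b 1 := BDSV.amp_pos ha 1
  have hcont : ContDiffOn ℝ ∞ e (Icc 0 1) := he.contDiff.contDiffOn
  have hpos : ∀ t ∈ Icc (0 : ℝ) 1, 0 < e t := fun t ht => by
    have := he.lower t ht; linarith
  have hD : ∀ t ∈ Icc (0 : ℝ) 1, |derivWithin e (Icc 0 1) t| ≤ K := fun t ht => by
    rw [(he.differentiable t).derivWithin (uniqueDiffOn_Icc one_pos t ht)]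
    simpa using he.abs_deriv_le t ht
  have hnorm' : BDSV.IsNormalisedProfile (c * 1) (fun s => BDSV.amp βs a b 1 * e (c⁻¹ * s)) :=
    BDSV.isNormalisedProfile_rescale one_pos hcont hpos hD hδ₁ hc hKc
  have hnorm : BDSV.IsNormalisedProfile c (fun s => BDSV.amp βs a b 1 * e (c⁻¹ * s)) := by
    rwa [mul_one] at hnorm'
  have hmaps : ∀ s ∈ Icc 0 c, c⁻¹ * s ∈ Icc (0 : ℝ) 1 := by
    intro s hs
    refine ⟨mul_nonneg (inv_nonneg.2 hc.le) hs.1, ?_⟩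
    calc c⁻¹ * s ≤ c⁻¹ * c := mul_le_mul_of_nonneg_left hs.2 (inv_nonneg.2 hc.le)
      _ = 1 := inv_mul_cancel₀ hc.ne'
  have he'le : ∀ s ∈ Icc 0 c, BDSV.amp βs a b 1 * e (c⁻¹ * s) ≤ BDSV.amp βs a b 1 := fun s hs => by
    calc BDSV.amp βs a b 1 * e (c⁻¹ * s) ≤ BDSV.amp βs a b 1 * 1 := by
          gcongr; exact he.upper _ (hmaps s hs)
      _ = BDSV.amp βs a b 1 := mul_one _
  have he'ge : ∀ s ∈ Icc 0 c,
      BDSV.amp βs a b 1 * BDSV.freq a b 0 ^ (-α) ≤ BDSV.amp βs a b 1 * e (c⁻¹ * s) := fun s hs => by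
    calc BDSV.amp βs a b 1 * BDSV.freq a b 0 ^ (-α) ≤ BDSV.amp βs a b 1 * (1 / 2) := by gcongr
      _ ≤ BDSV.amp βs a b 1 * e (c⁻¹ * s) := by
          gcongr
          have := he.lower _ (hmaps s hs); linarith
  exact ⟨hnorm, BDSV.inductiveEstimates_zero hM ha hβs he'le he'ge⟩

/-- **The limit of a De Rosa sequence, rescaled to viscosity `1`** (De Rosa 2019, §4.2: uniform
convergence by (4.12), passage to the limit in (NSR), the energy identity from (4.10),
interpolation and time regularity, and the transformation `v(x,t) = μ⁻¹ ṽ(x, μ⁻¹t)`). Let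
`(Z_q, P_q, S_q)` be a De Rosa sequence on `[0, c]` with viscosity `μ = c⁻¹` for the profile `ẽ`,
let `u(s,x) = lim_q Z_q(s,x)` (pointwise `limUnder`), and `v(t) = c u(ct)`. Then `v` is a weak
solution of the viscosity-`1` system on `(0,1)`, `v ∈ C^β([0,1] × 𝕋³)` (via
`DeRosa.timeRegularity` at an exponent `β' > β`), `∫|v(t)|² = c² ẽ(ct)`, and
`‖v(t)‖_∞ + [v(t)]_β ≤ c(1 + H_β)` where `H_β` bounds the Hölder sums of the scheme.
[cite: Derosa2018, §4.2 (proof of Thm. 2.1)] -/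
theorem limit_rescaled (htime : timeRegularity)
    {M βs γ α a b μ c β Hβ' Hβ : ℝ} {β' : ℝ≥0}
    (hM : 0 < M) (hβs0 : 0 < βs) (hγ : 0 < γ) (hγ3 : γ < 1 / 3)
    (hβ0 : 0 < β) (hβ1 : β ≤ 1) (hββ' : Real.toNNReal β < β') (hβ'pos : 0 < β') (hβ'lt : β' < 1 / 3)
    (hβ'1 : (β' : ℝ) ≤ 1)
    (ha1 : 1 < a) (hb1 : 1 < b) (hα0 : 0 < α) (hc : 0 < c) (hcμ : c * μ = 1)
    (hHβ' : ∀ q : ℕ, ∑ k ∈ Finset.range q,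
      ((2 * M) ^ (1 - (β' : ℝ)) * (6 * M) ^ (β' : ℝ)) * BDSV.freq a b (k + 1) ^ (-(βs - β')) ≤ Hβ')
    (hHβ'0 : 0 ≤ Hβ')
    (hHβ : ∀ q : ℕ, ∑ k ∈ Finset.range q,
      ((2 * M) ^ (1 - β) * (6 * M) ^ β) * BDSV.freq a b (k + 1) ^ (-(βs - β)) ≤ Hβ)
    (hHβ0 : 0 ≤ Hβ)
    {et : ℝ → ℝ} {Z : ℕ → ℝ → UnitAddTorus (Fin 3) → EuclideanSpace ℝ (Fin 3)}
    {Pq : ℕ → ℝ → UnitAddTorus (Fin 3) → ℝ}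
    {Sq : ℕ → ℝ → UnitAddTorus (Fin 3) → Fin 3 → EuclideanSpace ℝ (Fin 3)}
    (hS : IsDeRosaSequence M βs γ α a b μ c et Z Pq Sq)
    {u : ℝ → UnitAddTorus (Fin 3) → EuclideanSpace ℝ (Fin 3)}
    (hu : ∀ s x, u s x = limUnder atTop (fun q => Z q s x)) :
    Torus.IsWeakFracNSSolutionOn 1 γ 1 (fun t x => c • u (c * t) x) ∧
      FunctionSpaces.HolderOnSpaceTime (Real.toNNReal β) 1 (fun t x => c • u (c * t) x) ∧
      (∀ t ∈ Icc (0 : ℝ) 1, ∫ x, ‖c • u (c * t) x‖ ^ 2 = c ^ 2 * et (c * t)) ∧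
      ∀ t ∈ Icc (0 : ℝ) 1, FunctionSpaces.eBoundedHolderNorm (Real.toNNReal β) (fun x => c • u (c * t) x) ≤
        ENNReal.ofReal (c * (1 + Hβ)) := by
  have hβ'0 : (0 : ℝ) ≤ β' := β'.coe_nonneg
  have hlam_pos : ∀ q, 0 < BDSV.freq a b q := fun q => BDSV.freq_pos ha1.le q
  have hδ_pos : ∀ q, 0 < BDSV.amp βs a b q := fun q => BDSV.amp_pos ha1.le q
  have hδeq : ∀ q, BDSV.amp βs a b q = BDSV.freq a b q ^ (-(2 * βs)) := fun q => by
    rw [BDSV.amp, neg_mul]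
  have hFR : ∀ q, Torus.IsFracNSReynoldsOn (Icc 0 c) γ μ (Z q) (Pq q) (Sq q) := hS.isFracNSReynoldsOn
  have hIE : ∀ q, BDSV.InductiveEstimates M βs α a b c et q (Z q) (Sq q) := hS.inductiveEstimates
  /- Step 5: uniform convergence to `u`, vanishing stresses. -/
  have hε_sum : Summable fun q : ℕ => M * BDSV.freq a b (q + 1) ^ (-βs) :=
    (BDSV.summable_freq_succ_rpow_neg ha1 hb1 hβs0).mul_left M
  have hincr : ∀ q, ∀ t ∈ Icc 0 c, ∀ x, ‖Z (q + 1) t x - Z q t x‖ ≤ M * BDSV.freq a b (q + 1) ^ (-βs) := by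
    intro q t ht x
    obtain ⟨B₀, B₁, -, -, hsup, -, hB₀ε, -⟩ := (hS.velocityIncrementBound q).exists_bounds hc.le ha1.le
    exact (hsup t ht x).trans hB₀ε
  obtain ⟨g, hg⟩ := BDSV.exists_unifLimit_of_norm_sub_succ_le (S := Icc 0 c) (f := Z) hincr hε_sum
  obtain ⟨tail, htaildef⟩ : ∃ tail : ℕ → ℝ,
      tail = fun n => ∑' m, M * BDSV.freq a b (n + m + 1) ^ (-βs) := ⟨_, rfl⟩
  have hg' : ∀ q, ∀ t ∈ Icc 0 c, ∀ x, ‖Z q t x - g t x‖ ≤ tail q := by rw [htaildef]; exact hg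
  have htail_nn : ∀ n, 0 ≤ tail n := fun n => by
    rw [htaildef]
    exact tsum_nonneg fun m => mul_nonneg hM.le (Real.rpow_nonneg (hlam_pos _).le _)
  have htail : Tendsto tail atTop (𝓝 0) := by
    have h1 : tail = fun i => ∑' k, (fun q => M * BDSV.freq a b (q + 1) ^ (-βs)) (k + i) := by
      rw [htaildef]
      funext i
      exact tsum_congr fun k => by rw [add_comm i k]
    rw [h1]
    exact tendsto_sum_nat_add fun q => M * BDSV.freq a b (q + 1) ^ (-βs)
  -- the pointwise limit is `u` on `[0, c]`
  have hu_eq : ∀ t ∈ Icc 0 c, ∀ x, u t x = g t x := by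
    intro t ht x
    have htend : Tendsto (fun q => Z q t x) atTop (𝓝 (g t x)) := by
      rw [tendsto_iff_norm_sub_tendsto_zero]
      exact squeeze_zero (fun q => norm_nonneg _) (fun q => hg' q t ht x) htail
    rw [hu t x]
    exact htend.limUnder_eq
  have hũ' : ∀ q, ∀ t ∈ Icc 0 c, ∀ x, ‖Z q t x - u t x‖ ≤ tail q := fun q t ht x => by
    rw [hu_eq t ht x]; exact hg' q t ht x
  have hconvT' : ∀ η > 0, ∃ N : ℕ, ∀ q ≥ N, ∀ t ∈ Icc 0 c, ∀ x, ‖Z q t x - u t x‖ ≤ η := by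
    intro η hη
    obtain ⟨N, hN⟩ := eventually_atTop.1 (htail.eventually_le_const hη)
    exact ⟨N, fun q hq t ht x => (hũ' q t ht x).trans (hN q hq)⟩
  have hδ_tend : Tendsto (fun q => BDSV.amp βs a b (q + 1)) atTop (𝓝 0) :=
    (BDSV.summable_freq_succ_rpow_neg ha1 hb1
      (by positivity : (0 : ℝ) < 2 * βs)).tendsto_atTop_zero.congr fun q => (hδeq (q + 1)).symm
  have hstressT' : ∀ η > 0, ∃ N : ℕ, ∀ q ≥ N, ∀ t ∈ Icc 0 c, ∀ x, ‖Sq q t x‖ ≤ η := by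
    intro η hη
    obtain ⟨N, hN⟩ := eventually_atTop.1 (hδ_tend.eventually_le_const hη)
    refine ⟨N, fun q hq t ht x => ((hIE q).stress_le t ht x).trans ?_⟩
    calc BDSV.amp βs a b (q + 1) * BDSV.freq a b q ^ (-3 * α)
        ≤ BDSV.amp βs a b (q + 1) * 1 := by
          gcongr
          · exact (hδ_pos _).le
          · rw [neg_mul]
            exact BDSV.freq_rpow_neg_le_one ha1.le (by positivity) q
      _ ≤ η := by rw [mul_one]; exact hN q hq
  /- Step 6: uniform spatial Hölder bounds, exponents `β'` and `β`. -/
  have hholv : ∀ {θ : ℝ}, 0 ≤ θ → θ ≤ 1 → ∀ q, ∀ t ∈ Icc 0 c, ∀ x y, ‖Z q t x - Z q t y‖ ≤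
      (∑ k ∈ Finset.range q, ((2 * M) ^ (1 - θ) * (6 * M) ^ θ) * BDSV.freq a b (k + 1) ^ (-(βs - θ))) *
        dist x y ^ θ := fun hθ0 hθ1 q t ht x y =>
    norm_sub_le_holderSum hS hc.le ha1.le hM.le hθ0 hθ1 q ht x y
  /- Step 7: undo the scaling: `v_q(t) = c Z_q(ct)` on `[0,1] = [0, c/c]`, viscosity `c μ = 1`. -/
  have hcc : c / c = 1 := div_self hc.ne'
  have hct : ∀ t ∈ Icc (0 : ℝ) 1, c * t ∈ Icc 0 c := fun t ht =>
    ⟨mul_nonneg hc.le ht.1, by nlinarith [ht.2]⟩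
  have hFRv : ∀ q, Torus.IsFracNSReynoldsOn (Icc 0 1) γ 1 (fun t x => c • Z q (c * t) x)
      (fun t x => c ^ 2 * Pq q (c * t) x) (fun t x => c ^ 2 • Sq q (c * t) x) := by
    intro q
    have := (hFR q).timeRescale hc hc
    rwa [hcc, hcμ] at this
  have hconv : ∀ η > 0, ∃ N : ℕ, ∀ q ≥ N, ∀ t ∈ Icc (0 : ℝ) 1, ∀ x,
      ‖(fun t x => c • Z q (c * t) x) t x - (fun t x => c • u (c * t) x) t x‖ ≤ η := by
    intro η hη
    obtain ⟨N, hN⟩ := hconvT' (η / c) (div_pos hη hc)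
    refine ⟨N, fun q hq t ht x => ?_⟩
    rw [← smul_sub, norm_smul, Real.norm_eq_abs, abs_of_pos hc]
    calc c * ‖Z q (c * t) x - u (c * t) x‖ ≤ c * (η / c) := by
          gcongr
          exact hN q hq _ (hct t ht) x
      _ = η := by field_simp
  have hstress : ∀ η > 0, ∃ N : ℕ, ∀ q ≥ N, ∀ t ∈ Icc (0 : ℝ) 1, ∀ x,
      ‖(fun t x => c ^ 2 • Sq q (c * t) x) t x‖ ≤ η := by
    intro η hη
    obtain ⟨N, hN⟩ := hstressT' (η / c ^ 2) (div_pos hη (by positivity))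
    refine ⟨N, fun q hq t ht x => ?_⟩
    rw [norm_smul, Real.norm_eq_abs, abs_of_pos (by positivity : (0 : ℝ) < c ^ 2)]
    calc c ^ 2 * ‖Sq q (c * t) x‖ ≤ c ^ 2 * (η / c ^ 2) := by
          gcongr
          exact hN q hq _ (hct t ht) x
      _ = η := by field_simp
  have hHol : ∃ C' : ℝ≥0, ∀ q, ∀ t ∈ Icc (0 : ℝ) 1,
      HolderWith C' β' ((fun t x => c • Z q (c * t) x) t) := by
    refine ⟨Real.toNNReal (c * Hβ'), fun q t ht =>
      BDSV.holderWith_of_norm_sub_le (by positivity) fun x y => ?_⟩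
    rw [← smul_sub, norm_smul, Real.norm_eq_abs, abs_of_pos hc, mul_assoc]
    refine mul_le_mul_of_nonneg_left ?_ hc.le
    calc ‖Z q (c * t) x - Z q (c * t) y‖
        ≤ (∑ k ∈ Finset.range q, ((2 * M) ^ (1 - (β' : ℝ)) * (6 * M) ^ (β' : ℝ)) *
            BDSV.freq a b (k + 1) ^ (-(βs - β'))) * dist x y ^ (β' : ℝ) := hholv hβ'0 hβ'1 q _ (hct t ht) x y
      _ ≤ Hβ' * dist x y ^ (β' : ℝ) := by
          gcongr
          exact hHβ' q
  /- Step 8: the energy identity at the limit on `[0, c]`; sup and Hölder bounds of the limit. -/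
  have hcontũ : ContinuousOn (FunctionSpaces.Torus.stLift u) (Icc 0 c ×ˢ univ) :=
    Torus.continuousOn_stLift_of_unifLimit (fun q => (hFR q).smooth_velocity.continuousOn_stLift) hconvT'
  have hEn : ∀ s ∈ Icc 0 c, ∫ x, ‖u s x‖ ^ 2 = et s := fun s hs =>
    BDSV.integral_norm_sq_eq_of_unifLimit (S := Icc 0 c) (w := Z)
      (e := et) (ρ := fun q => BDSV.amp βs a b (q + 1)) (τ := tail)
      (fun q s hs => ((hFR q).smooth_velocity.isSmooth_slice hs).continuous)
      (fun s hs => FunctionSpaces.Torus.continuous_slice_of_continuousOn_stLift hcontũ hs)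
      (fun q s hs x => ((hIE q).velocity_le s hs x).trans
        (by linarith [Real.sqrt_nonneg (BDSV.amp βs a b q)]))
      hũ' htail_nn htail
      (fun q s hs => by
        rw [abs_le]
        constructor
        · have hge := (hIE q).energy_ge s hs
          have hnn : 0 ≤ BDSV.amp βs a b (q + 1) * BDSV.freq a b q ^ (-α) :=
            mul_nonneg (hδ_pos _).le (Real.rpow_nonneg (hlam_pos q).le _)
          linarith [(hδ_pos (q + 1)).le]
        · exact (hIE q).energy_le s hs)
      hδ_tend hs
  have hsup1 : ∀ s ∈ Icc 0 c, ∀ x, ‖u s x‖ ≤ 1 := by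
    intro s hs x
    refine le_of_forall_pos_le_add fun η hη => ?_
    obtain ⟨N, hN⟩ := hconvT' η hη
    calc ‖u s x‖ = ‖(u s x - Z N s x) + Z N s x‖ := by rw [sub_add_cancel]
      _ ≤ ‖u s x - Z N s x‖ + ‖Z N s x‖ := norm_add_le _ _
      _ ≤ η + 1 := by
          refine add_le_add ?_ (((hIE N).velocity_le s hs x).trans
            (by linarith [Real.sqrt_nonneg (BDSV.amp βs a b N)]))
          rw [norm_sub_rev]; exact hN N le_rfl s hs x
      _ = 1 + η := add_comm _ _
  have hholβ : ∀ s ∈ Icc 0 c, ∀ x y, ‖u s x - u s y‖ ≤ Hβ * dist x y ^ β := by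
    intro s hs x y
    refine le_of_forall_pos_le_add fun η hη => ?_
    obtain ⟨N, hN⟩ := hconvT' (η / 2) (half_pos hη)
    have hq := hholv hβ0.le hβ1 N s hs x y
    have hd : 0 ≤ dist x y ^ β := Real.rpow_nonneg dist_nonneg _
    calc ‖u s x - u s y‖
        = ‖(Z N s x - Z N s y) - ((Z N s x - u s x) - (Z N s y - u s y))‖ := by
          congr 1; abel
      _ ≤ ‖Z N s x - Z N s y‖ + ‖(Z N s x - u s x) - (Z N s y - u s y)‖ := norm_sub_le _ _
      _ ≤ Hβ * dist x y ^ β + (η / 2 + η / 2) := by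
          refine add_le_add (hq.trans (mul_le_mul_of_nonneg_right (hHβ N) hd)) ?_
          exact (norm_sub_le _ _).trans (add_le_add (hN N le_rfl s hs x) (hN N le_rfl s hs y))
      _ = Hβ * dist x y ^ β + η := by ring
  /- Step 9: conclusion. -/
  refine ⟨Torus.isWeakFracNSSolutionOn_of_unifLimit one_pos hγ.le hFRv hconv hstress,
    htime 1 one_pos γ hγ hγ3 β' hβ'pos hβ'lt _ _ _ _ hFRv hconv hstress hHol (Real.toNNReal β) hββ',
    fun t ht => ?_, fun t ht => ?_⟩
  · have hsq : ∀ x, ‖c • u (c * t) x‖ ^ 2 = c ^ 2 * ‖u (c * t) x‖ ^ 2 := fun x => by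
      rw [norm_smul, Real.norm_eq_abs, abs_of_pos hc, mul_pow]
    simp_rw [hsq, integral_const_mul]
    rw [hEn _ (hct t ht)]
  · have hct' := hct t ht
    have hsupv : FunctionSpaces.eSupNorm (fun x => c • u (c * t) x) ≤ ENNReal.ofReal c := by
      refine iSup_le fun x => ?_
      rw [← ofReal_norm, norm_smul, Real.norm_eq_abs, abs_of_pos hc]
      refine ENNReal.ofReal_le_ofReal ?_
      calc c * ‖u (c * t) x‖ ≤ c * 1 := by gcongr; exact hsup1 _ hct' x
        _ = c := mul_one c
    have hHolv : HolderWith (Real.toNNReal (c * Hβ)) (Real.toNNReal β) (fun x => c • u (c * t) x) := by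
      refine BDSV.holderWith_of_norm_sub_le (by positivity) fun x y => ?_
      rw [Real.coe_toNNReal β hβ0.le, ← smul_sub, norm_smul, Real.norm_eq_abs, abs_of_pos hc, mul_assoc]
      exact mul_le_mul_of_nonneg_left (hholβ _ hct' x y) hc.le
    calc FunctionSpaces.eBoundedHolderNorm (Real.toNNReal β) (fun x => c • u (c * t) x)
        ≤ ENNReal.ofReal c + ENNReal.ofReal (c * Hβ) := by
          rw [FunctionSpaces.eBoundedHolderNorm_def]
          exact add_le_add hsupv (hHolv.eHolderNorm_le.trans (le_of_eq rfl))
      _ = ENNReal.ofReal (c * (1 + Hβ)) := by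
          rw [← ENNReal.ofReal_add hc.le (by positivity)]; ring_nf

/-- **De Rosa 2019, Thm. 2.1 from Prop. 4.1 (iterated, regime `γ < β`) and the time-regularity
step** — the assembly of §4.2 of arXiv:1801.10235 (see the module docstring for the argument and
its formalisation): the named facts `DeRosa.iterativeSchemeLT` (`DeRosaStep`: Prop. 4.1 run from
zero for dissipation exponents below the Hölder exponent of the scheme, the regime covered by
the printed proof of Prop. 4.1) and `DeRosa.timeRegularity` (`DeRosaScheme`) imply the named
fact `DeRosa2019_thm21` of `FractionalNSPrescribedEnergy` (with the printed window
`c₀ = T₀ = 1`); the scheme is run with Hölder exponent `βₛ`, `γ < β < β' < βₛ < 1/3`.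
[cite: Derosa2018, §4.2 (proof of Thm. 2.1)] -/
theorem DeRosa2019_thm21_of_schemeLT (hit : iterativeSchemeLT) (htime : timeRegularity) :
    DeRosa2019_thm21 := by
  intro γ β hγ hγβ hβ3
  have hβ0 : 0 < β := hγ.trans hγβ
  /- Step 0: exponents `β < β' < βₛ < 1/3`, `b`, and the constants `M, α₀, α, a₀` of Prop. 4.1. -/
  obtain ⟨β', βs, hββ', hβ'pos, hβ'lt, hβ'1, hβ'βs, hβs0, hβs3, hββ'nn⟩ := exists_scheme_exponents hβ0 hβ3
  have hβ1 : β ≤ 1 := by linarith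
  obtain ⟨b, hb1, hb2, hb43⟩ : ∃ b : ℝ, 1 < b ∧ b < (1 - βs) / (2 * βs) ∧ b < 4 / 3 := by
    have hbub : 1 < (1 - βs) / (2 * βs) := by rw [lt_div_iff₀ (by positivity)]; linarith
    refine ⟨min ((1 + (1 - βs) / (2 * βs)) / 2) (7 / 6), ?_, ?_, ?_⟩
    · exact lt_min (by linarith) (by norm_num)
    · exact (min_le_left _ _).trans_lt (by linarith)
    · exact (min_le_right _ _).trans_lt (by norm_num)
  obtain ⟨M, hM, hit₁⟩ := hit
  obtain ⟨α₀, hα₀, hit₂⟩ := hit₁ βs hβs0 hβs3 γ hγ (show γ < βs by linarith) b hb1 hb2 hb43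
  clear hit₁
  obtain ⟨α, hα0, hα1⟩ : ∃ α : ℝ, 0 < α ∧ α < α₀ := ⟨α₀ / 2, by positivity, by linarith⟩
  obtain ⟨a₀, ha₀1, hit₃⟩ := hit₂ α hα0 hα1
  clear hit₂
  /- Step 1: the `K`-independent threshold `aS` (`aS ≥ a₀`, `aS ≥ 2`, `aS^{-α} ≤ 1/2`) and the
     `K`-independent constants `H_{β'}`, `H_β`, `C`. -/
  have hev : ∀ᶠ a : ℝ in atTop, a₀ ≤ a ∧ 2 ≤ a ∧ a ^ (-α) ≤ 1 / 2 :=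
    (eventually_ge_atTop a₀).and ((eventually_ge_atTop 2).and
      ((tendsto_rpow_neg_atTop hα0).eventually_le_const (by norm_num)))
  obtain ⟨aS, ha₀aS, haS2, haSα⟩ := hev.exists
  clear hev
  have haS1 : (1 : ℝ) < aS := by linarith
  obtain ⟨Hβ', hHβ'0, hHβ'⟩ := exists_holderSum_le (Kc := (2 * M) ^ (1 - (β' : ℝ)) * (6 * M) ^ (β' : ℝ))
    haS1 hb1 (sub_pos.2 hβ'βs) (by positivity)
  obtain ⟨Hβ, hHβ0, hHβ⟩ := exists_holderSum_le (Kc := (2 * M) ^ (1 - β) * (6 * M) ^ β)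
    haS1 hb1 (sub_pos.2 (hββ'.trans hβ'βs)) (by positivity)
  obtain ⟨C, hC_def⟩ : ∃ C : ℝ, C = (4 * Real.pi) ^ βs * aS ^ (b * βs) * (1 + Hβ) := ⟨_, rfl⟩
  have hC : 0 < C := by rw [hC_def]; positivity
  refine ⟨1, 1, C, one_pos, one_pos, hC, fun K hK => ?_⟩
  have hK0 : 0 < K := by linarith
  have hK1 : 1 ≤ K := hK.le
  /- Step 2: the parameter `a = max(aS, K^{1/(3βₛb)})`, `δ₁`, `μ = δ₁^{1/2}`, `c = μ⁻¹`. -/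
  obtain ⟨pK, hpK_def⟩ : ∃ pK : ℝ, pK = 1 / (3 * βs * b) := ⟨_, rfl⟩
  have hpK0 : 0 < pK := by rw [hpK_def]; positivity
  obtain ⟨a, ha_def⟩ : ∃ a : ℝ, a = max aS (K ^ pK) := ⟨_, rfl⟩
  have haSa : aS ≤ a := by rw [ha_def]; exact le_max_left _ _
  have hKa : K ^ pK ≤ a := by rw [ha_def]; exact le_max_right _ _
  have ha₀a : a₀ ≤ a := ha₀aS.trans haSa
  have ha1 : (1 : ℝ) < a := by linarith
  have ha0 : (0 : ℝ) < a := by linarith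
  have hlam_pos : ∀ q, 0 < BDSV.freq a b q := fun q => BDSV.freq_pos ha1.le q
  have hδeq : ∀ q, BDSV.amp βs a b q = BDSV.freq a b q ^ (-(2 * βs)) := fun q => by
    rw [BDSV.amp, neg_mul]
  obtain ⟨δ₁, hδ₁_def⟩ : ∃ δ₁ : ℝ, δ₁ = BDSV.amp βs a b 1 := ⟨_, rfl⟩
  have hδ₁ : 0 < δ₁ := by rw [hδ₁_def]; exact BDSV.amp_pos ha1.le 1
  have hδ₁1 : δ₁ < 1 := by
    rw [hδ₁_def, hδeq]
    exact Real.rpow_lt_one_of_one_lt_of_neg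
      (lt_of_lt_of_le (by linarith [Real.two_le_pi]) (BDSV.two_pi_le_freq ha1.le 1)) (by linarith)
  obtain ⟨μ, hμ_def⟩ : ∃ μ : ℝ, μ = Real.sqrt δ₁ := ⟨_, rfl⟩
  have hμ : 0 < μ := by rw [hμ_def]; exact Real.sqrt_pos.2 hδ₁
  have hμ1 : μ < 1 := by rw [hμ_def, Real.sqrt_lt' one_pos]; simpa using hδ₁1
  have hμsq : μ ^ 2 = δ₁ := by rw [hμ_def]; exact Real.sq_sqrt hδ₁.le
  obtain ⟨c, hc_def⟩ : ∃ c : ℝ, c = μ⁻¹ := ⟨_, rfl⟩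
  have hc : 0 < c := by rw [hc_def]; exact inv_pos.2 hμ
  have hcμ : c * μ = 1 := by rw [hc_def]; exact inv_mul_cancel₀ hμ.ne'
  have hc2δ : c ^ 2 * δ₁ = 1 := by
    rw [← hμsq, hc_def, inv_pow, inv_mul_cancel₀ (pow_ne_zero 2 hμ.ne')]
  -- `λ₀^{-α} ≤ 1/2`
  have hlam0 : BDSV.freq a b 0 ^ (-α) ≤ 1 / 2 :=
    ((BDSV.freq_rpow_neg_le_rpow_neg ha1.le hb1.le hα0.le 0).trans
      (Real.rpow_le_rpow_of_nonpos (by linarith) haSa (by linarith))).trans haSα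
  -- `δ₁^{3/2} K ≤ 1`, in the form `δ₁ K ≤ c`
  have hδK : δ₁ * K ≤ c := by
    have h1 : δ₁ ≤ a ^ (-(2 * βs * b)) := by
      rw [hδ₁_def, hδeq]
      have hab : a ^ b ≤ BDSV.freq a b 1 := by
        have := BDSV.rpow_pow_le_freq ha0.le b 1
        rwa [pow_one] at this
      calc BDSV.freq a b 1 ^ (-(2 * βs)) ≤ (a ^ b) ^ (-(2 * βs)) :=
            Real.rpow_le_rpow_of_nonpos (Real.rpow_pos_of_pos ha0 b) hab (by linarith)
        _ = a ^ (-(2 * βs * b)) := by rw [← Real.rpow_mul ha0.le]; ring_nf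
    have h2 : a ^ (-(2 * βs * b)) ≤ (K ^ pK) ^ (-(2 * βs * b)) :=
      Real.rpow_le_rpow_of_nonpos (Real.rpow_pos_of_pos hK0 _) hKa (by nlinarith)
    have h3 : (K ^ pK) ^ (-(2 * βs * b)) = K ^ (-(2 / 3 : ℝ)) := by
      rw [← Real.rpow_mul hK0.le, hpK_def]
      congr 1
      field_simp
    have hδ23 : δ₁ ≤ K ^ (-(2 / 3 : ℝ)) := h1.trans (h3 ▸ h2)
    have hμ13 : μ ≤ K ^ (-(1 / 3 : ℝ)) := by
      rw [hμ_def, Real.sqrt_le_left (Real.rpow_nonneg hK0.le _), ← Real.rpow_natCast,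
        ← Real.rpow_mul hK0.le]
      norm_num
      exact hδ23
    -- `δ₁ K = δ₁ K (c μ) = c (δ₁ μ K) ≤ c`
    have h4 : δ₁ * (μ * K) ≤ 1 :=
      calc δ₁ * (μ * K) ≤ K ^ (-(2 / 3 : ℝ)) * (K ^ (-(1 / 3 : ℝ)) * K) := by gcongr
        _ = 1 := by
            rw [← Real.rpow_add_one hK0.ne', ← Real.rpow_add hK0]
            norm_num
    calc δ₁ * K = c * (δ₁ * (μ * K)) := by
          rw [show c * (δ₁ * (μ * K)) = (c * μ) * (δ₁ * K) by ring, hcμ, one_mul]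
      _ ≤ c * 1 := mul_le_mul_of_nonneg_left h4 hc.le
      _ = c := mul_one c
  -- the bound on `c`: `c = λ₁^{βₛ} ≤ (4π)^{βₛ} aS^{bβₛ} K^{4/9}`
  have hc_le : c * (1 + Hβ) ≤ C * K ^ (4 / 9 : ℝ) := by
    have hc_eq : c = BDSV.freq a b 1 ^ βs := by
      rw [hc_def, hμ_def, hδ₁_def, BDSV.sqrt_amp ha1.le, Real.rpow_neg (hlam_pos 1).le, inv_inv]
    have h1 : BDSV.freq a b 1 ≤ 4 * Real.pi * a ^ b := by
      have := BDSV.freq_le_four_pi_mul_rpow ha1.le hb1.le 1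
      rwa [pow_one] at this
    have h2 : BDSV.freq a b 1 ^ βs ≤ (4 * Real.pi) ^ βs * (a ^ b) ^ βs := by
      rw [← Real.mul_rpow (by positivity) (Real.rpow_nonneg ha0.le b)]
      exact Real.rpow_le_rpow (hlam_pos 1).le h1 hβs0.le
    have hKp : (K ^ pK) ^ (b * βs) = K ^ (1 / 3 : ℝ) := by
      rw [← Real.rpow_mul hK0.le, hpK_def]
      congr 1
      field_simp
    have honeS : 1 ≤ aS ^ (b * βs) := Real.one_le_rpow haS1.le (by positivity)
    have honeK : 1 ≤ K ^ (1 / 3 : ℝ) := Real.one_le_rpow hK1 (by positivity)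
    have hmax : (a ^ b) ^ βs ≤ aS ^ (b * βs) * K ^ (1 / 3 : ℝ) := by
      rw [← Real.rpow_mul ha0.le]
      rcases le_total aS (K ^ pK) with h | h
      · have : a = K ^ pK := by rw [ha_def, max_eq_right h]
        rw [this, hKp]
        exact le_mul_of_one_le_left (by positivity) honeS
      · have : a = aS := by rw [ha_def, max_eq_left h]
        rw [this]
        exact le_mul_of_one_le_right (by positivity) honeK
    have h49 : K ^ (1 / 3 : ℝ) ≤ K ^ (4 / 9 : ℝ) := Real.rpow_le_rpow_of_exponent_le hK1 (by norm_num)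
    have hcK : c ≤ (4 * Real.pi) ^ βs * aS ^ (b * βs) * K ^ (4 / 9 : ℝ) := by
      rw [hc_eq]
      refine h2.trans ?_
      rw [mul_assoc]
      refine mul_le_mul_of_nonneg_left (hmax.trans ?_) (by positivity)
      exact mul_le_mul_of_nonneg_left h49 (by positivity)
    calc c * (1 + Hβ) ≤ ((4 * Real.pi) ^ βs * aS ^ (b * βs) * K ^ (4 / 9 : ℝ)) * (1 + Hβ) :=
          mul_le_mul_of_nonneg_right hcK (by positivity)
      _ = C * K ^ (4 / 9 : ℝ) := by rw [hC_def]; ring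
  /- Step 3: the iteration data for this `a`, viscosity `μ` and time `c`; the solution map. -/
  obtain ⟨V, P, St, hseq, hagree⟩ := hit₃ a ha₀a μ hμ hμ1 c hc
  clear hit₃
  have hadm : ∀ {e : ℝ → ℝ}, IsEnergyProfile 1 1 K e →
      IsAdmissibleProfile M βs α a b c (fun s => δ₁ * e (c⁻¹ * s)) := fun {e} he => by
    rw [hδ₁_def]
    exact isAdmissibleProfile_rescale hM.le hβs0.le ha1.le hc (hδ₁_def ▸ hδK) hlam0 he
  refine ⟨fun e t x => c • limUnder atTop (fun q => V (fun s => δ₁ * e (c⁻¹ * s)) q (c * t) x),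
    fun e he => ?_, fun e₁ e₂ he₁ he₂ h0 => ?_⟩
  · have hS := hseq _ (hadm he)
    obtain ⟨hweak, hhol, hen, hbd⟩ := limit_rescaled htime hM hβs0 hγ (hγβ.trans hβ3) hβ0 hβ1 hββ'nn
      hβ'pos hβ'lt hβ'1 ha1 hb1 hα0 hc hcμ (hHβ' a haSa) hHβ'0 (hHβ a haSa) hHβ0 hS
      (u := fun s x => limUnder atTop (fun q => V (fun s => δ₁ * e (c⁻¹ * s)) q s x)) (fun s x => rfl)
    refine ⟨hweak, hhol, fun t ht => ?_, fun t ht => (hbd t ht).trans (ENNReal.ofReal_le_ofReal hc_le)⟩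
    rw [hen t ht, show c⁻¹ * (c * t) = t by field_simp, ← mul_assoc, hc2δ, one_mul]
  · -- same datum
    funext x
    show c • limUnder atTop (fun q => V (fun s => δ₁ * e₁ (c⁻¹ * s)) q (c * 0) x) =
      c • limUnder atTop (fun q => V (fun s => δ₁ * e₂ (c⁻¹ * s)) q (c * 0) x)
    rw [mul_zero]
    have hr0 : (fun s => δ₁ * e₁ (c⁻¹ * s)) 0 = (fun s => δ₁ * e₂ (c⁻¹ * s)) 0 := by
      show δ₁ * e₁ (c⁻¹ * 0) = δ₁ * e₂ (c⁻¹ * 0)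
      rw [mul_zero, h0]
    have hVq : ∀ q, V (fun s => δ₁ * e₁ (c⁻¹ * s)) q 0 = V (fun s => δ₁ * e₂ (c⁻¹ * s)) q 0 :=
      hagree _ _ (hadm he₁) (hadm he₂) hr0
    have hfun : (fun q => V (fun s => δ₁ * e₁ (c⁻¹ * s)) q 0 x) =
        fun q => V (fun s => δ₁ * e₂ (c⁻¹ * s)) q 0 x := funext fun q => by rw [hVq q]
    rw [hfun]

end Assembly

end DeRosa

/-! ## Consequence for the barrier -/

/-- **De Rosa 2019, Thm. 2.1 from the iteration fact (regime `γ < β`) and time regularity**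
(root-level name for users of `DeRosa2019_thm21`):
`DeRosa.iterativeSchemeLT → DeRosa.timeRegularity → DeRosa2019_thm21`.
[cite: Derosa2018, §4.2 (proof of Thm. 2.1)] -/
theorem DeRosa2019_thm21_of_iterativeSchemeLT_of_timeRegularity (hit : DeRosa.iterativeSchemeLT)
    (htime : DeRosa.timeRegularity) : DeRosa2019_thm21 :=
  DeRosa.DeRosa2019_thm21_of_schemeLT hit htime

end Literature.Analysis.FluidPDE
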